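import Summits.Ventures.CertifiedManyBodySolver.Statement
import Summits.Ventures.CertifiedManyBodySolver.Certificates.HubbardChain_n1_rows99_100
import Summits.Ventures.CertifiedManyBodySolver.Certificates.HubbardChain_n1_umps_c2_chi256
import HarnessLib
import HarnessLib.Audit

/-!
# Ventures/CertifiedManyBodySolver — Certificates/HubbardChain_n1_two_sided_U4_r100.lean

HONEST FRAMING: first certified bounds; not a superconductivity verdict; every number certified or labelled float.

Half-filled Hubbard chain (`t = 1`, thermodynamic limit), `U = 4`: `M1EnergyRow 4 lo hi` pairing the best certified LOWER row #100 (op-09 basis-search shard H, kit j109325, ref-1 R1.18; BOUND ONLY per D-18 r55; Certificates/HubbardChain_n1_rows99_100.lean, staged g148; tighter than #76 by 1.077e-3) with the chi = 256 ncell = 2 uMPS UPPER row #63 (Certificates/HubbardChain_n1_umps_c2_chi256.lean, p243287). Supersedes the width of `m1_U4_row_r76_r63_of` (HubbardChain_n1_two_sided_U4_r76.lean) — both stand; NOT an M1 pass (`M1Width` = 1e-3).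
The theorem takes BOTH claim nodes as hypotheses — nothing here asserts a bound unconditionally. Generated by `gen_two_sided_g148.py`
(pub-mbboot-typer g148): endpoints PARSED from the one-sided theorem texts, `lo < hi` re-checked in exact arithmetic before emission.
-/

noncomputable section

namespace Summit.Ventures.CertifiedManyBodySolver.Certificates

open Literature.MathematicalPhysics.QuantumLattice
open Literature.MathematicalPhysics.QuantumLattice.ThermodynamicLimit

/-- TWO-SIDED row `M1EnergyRow 4 (-711909726391252435114551/1208925819614629174706176) (-630820875953/1099511627776)` = `(-711909726391252435114551/1208925819614629174706176) ≤ e ≤ (-630820875953/1099511627776)` (width `18314838237087229844023/1208925819614629174706176 ≈ 1.5150e-02`), PROVED from the CERTIFIED.md claim nodes of LOWER row #100 (`cert_r100_bs_M1U4_w10_d2_b4_R2_eomx_X_L7_T7_1c3f1cc8`, theorem `m1_U4_lower_r100_of`) and UPPER row #63 (`cert_r63_hub1d_U4_chi256_c2`, theorem `m1_U4_upper_r63_of`); `M1EnergyRow` is the conjunction lower ∧ upper. -/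
theorem m1_U4_row_r100_r63_of (hlo : cert_r100_bs_M1U4_w10_d2_b4_R2_eomx_X_L7_T7_1c3f1cc8) (hup : cert_r63_hub1d_U4_chi256_c2) : M1EnergyRow 4 (-711909726391252435114551/1208925819614629174706176) (-630820875953/1099511627776) :=
  ⟨m1_U4_lower_r100_of hlo, m1_U4_upper_r63_of hup⟩

end Summit.Ventures.CertifiedManyBodySolver.Certificates

end
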